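import Literature.Geometry.Kaehler.RiemannSurfaceSymmetricSquareInvariants
import Literature.Geometry.Kaehler.RiemannSurfaceIsotypicDecomposition
import Literature.RepresentationTheory.FiniteGroups.FrobeniusSchurIndicator
import HarnessLib

/-!
# `N = dim (S²𝓗¹(M))^G` in multiplicities, for ANY finite `G ≤ Aut M`:
# `2N = Σ_{χ ∈ Irr(G)} μ_χ μ_χ̄ + Σ_{χ ∈ Irr(G)} ν₂(χ) μ_χ`, i.e.
# `N = Σ_{{χ, χ̄}, χ̄ ≠ χ} μ_χ μ_χ̄ + Σ_{χ̄ = χ} μ_χ(μ_χ + ν₂(χ))/2`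
# (Frediani–Ghigi–Penegini (2.5)–(2.6), the sum over `G` carried out by the orthogonality relations and the
# Frobenius–Schur count, Isaacs (2.14), Lemma 4.4, Theorem 4.5)

Layer `Literature/Geometry/Kaehler`, sequel of `RiemannSurfaceSymmetricSquareInvariants` (for ANY finite
`G ≤ Aut M`: `2|G|·N = Σ_{x ∈ G} (χ_ρ(x)² + χ_ρ(x²))`, `N = dim (S²𝓗¹(M))^G`, `χ_ρ(x) = tr(x|𝓗¹(M))`; row g11),
of `RiemannSurfaceSymmetricSquareInvariantsAbelian` (the ABELIAN case `2N = Σ_{χ ∈ Ĝ} n_χ n_{χ⁻¹} + Σ_{χ² = 1} n_χ`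
in eigenspace dimensions; gen 38) and of `RiemannSurfaceIsotypicDecomposition` (gen 39: the canonical decomposition
`𝓗¹(M) = ⊕_χ 𝓗¹(M)_χ`, `dim 𝓗¹(M)_χ = χ(1)·μ_χ` with `μ_χ = ⟨χ, χ_{𝓗¹(M)}⟩` given by the Chevalley–Weil formula,
`μ_1 = γ = g(M/G)`).  Here the character sum of Frediani–Ghigi–Penegini is evaluated for an ARBITRARY finite group in
the multiplicities `μ_χ = ⟨χ, χ_σ⟩` (the tree's `classInner χ σ.character`), the conjugate characters `χ̄ = star χ`
and the Frobenius–Schur indicators `ν₂(χ) = |G|⁻¹ Σ_g χ(g²)` (the tree's `frobeniusSchur 2 χ ∈ {0, ±1}`,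
`Literature.RepresentationTheory.FiniteGroups.FrobeniusSchurIndicator`).  Sources, as printed:

P. Frediani, A. Ghigi, M. Penegini, *Shimura varieties in the Torelli locus via Galois coverings*, IMRN 2015
(arXiv:1402.0973 pp. 14, 19), `ρ : G → GL(H⁰(C, K_C))`, `N := dim(S²H⁰(C, K_C))^G`:
> 2.12. […] Using the orthogonality relations and (2.4), `N` can be computed as follows:
> (2.5) `N = (χ_{S²ρ}, 1) = |G|⁻¹ Σ_{x ∈ G} χ_{S²ρ}(x) = (2|G|)⁻¹ Σ_{x ∈ G} (χ_ρ(x²) + χ_ρ(x)²)`.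
> Since `χ_ρ = Σ_{χ ∈ Irr(G)} μ_χ χ` we obtain
> (2.6) `N = (2|G|)⁻¹ Σ_{x ∈ G} ( (Σ_{χ ∈ Irr(G)} μ_χ χ(x))² + Σ_{χ ∈ Irr(G)} μ_χ χ(x²) )`
> where `Irr(G)` denotes the set of irreducible characters of `G`. Formula (2.6) is the one used in our MAGMA
> script.
> **Corollary 3.11.** Let `C` be a curve and `G` a subgroup of `Aut(C)`. If `(S²H⁰(C, K_C))^G = {0}`, then `J(C)`
> is an abelian variety of CM type.
> 3.12. […] If `C` and `G` satisfy the hypothesis of Corollary 3.11, then clearly the corresponding family is a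
> point […].

I. M. Isaacs, *Character Theory of Finite Groups* (1976), (2.14) (first orthogonality relation
`|G|⁻¹ Σ_g χ_i(g) \overline{χ_j(g)} = δ_{ij}`), (2.17) (`[χ, ψ] = [ψ, χ]` is a nonnegative integer for characters),
Lemma 4.4 (`ν_n(χ) = |G|⁻¹ Σ_{g ∈ G} χ(gⁿ)`) and Theorem 4.5 (Frobenius–Schur: for `χ ∈ Irr(G)`,
«(b) `ν₂(χ) = 1, −1,` or `0`; (c) `ν₂(χ) ≠ 0` iff `χ` is real valued», with «`[χ, χ̄] = [χ², 1_G]`» in the proof).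

So the two sums of (2.6) are `Σ_x (Σ_χ μ_χ χ(x))² = Σ_{χ,ψ} μ_χ μ_ψ Σ_x χ(x)ψ(x) = |G| Σ_{χ,ψ} μ_χ μ_ψ [χ, ψ̄] =
|G| Σ_χ μ_χ μ_χ̄` and `Σ_x Σ_χ μ_χ χ(x²) = |G| Σ_χ μ_χ ν₂(χ)`, whence `2N = Σ_χ μ_χ μ_χ̄ + Σ_χ ν₂(χ) μ_χ`; since
`ν₂(χ) = 0` unless `χ̄ = χ` this is `2N = Σ_{χ̄ = χ} μ_χ(μ_χ + ν₂(χ)) + Σ_{χ̄ ≠ χ} μ_χ μ_χ̄`, every summand a natural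
number (`μ(μ+1)`, `μ(μ−1)` or `μ_χ μ_χ̄`), and the non-real characters come in pairs `{χ, χ̄}` contributing
`2 μ_χ μ_χ̄`.  For `G ≤ Aut M` and `σ = 𝓗¹(M)`: `μ_1 = γ`, `1̄ = 1`, `ν₂(1) = 1`, so `2N = γ(γ+1) + Σ_{χ ≠ 1}(…)` and
`N = 0` forces `γ = 0` (3.12: «the corresponding family is a point»; for abelian `G` this is
`arithGenus_orbitSurface_eq_zero_of_finrank_invariants_symmSq_eq_zero` of the abelian file).

## What is proved (no definitions, no named facts, no instances)

* §1 (any finite-dimensional complex representation `σ` of a finite group `G`, `μ_χ = classInner χ σ.character`):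
  `character_eq_sum_classInner_smul` / `character_apply_eq_sum_classInner_mul` («`χ_ρ = Σ_{χ ∈ Irr(G)} μ_χ χ`»),
  **`sum_character_sq_eq_card_mul_sum_classInner`** (`Σ_x χ_σ(x)² = |G| Σ_χ μ_χ μ_χ̄`),
  **`sum_character_sq_apply_eq_card_mul_sum_frobeniusSchur`** (`Σ_x χ_σ(x²) = |G| Σ_χ ν₂(χ) μ_χ`),
  `two_mul_card_mul_finrank_invariants_symmSq_eq_sum_sum` ((2.6) verbatim),
  **`two_mul_finrank_invariants_symmSq_eq_sum_classInner`** (`2 dim(S²V)^G = Σ_χ μ_χ μ_χ̄ + Σ_χ ν₂(χ) μ_χ`),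
  `two_mul_finrank_invariants_altSq_eq_sum_classInner` (`2 dim(Λ²V)^G = Σ_χ μ_χ μ_χ̄ − Σ_χ ν₂(χ) μ_χ`),
  `finrank_invariants_symmSq_add_altSq_eq_sum_classInner` (`dim(S²V)^G + dim(Λ²V)^G = Σ_χ μ_χ μ_χ̄`),
  `finrank_invariants_symmSq_sub_altSq_eq_sum_frobeniusSchur` (`dim(S²V)^G − dim(Λ²V)^G = Σ_χ ν₂(χ) μ_χ`),
  **`two_mul_finrank_invariants_symmSq_eq_sum_filter_add`** (`2 dim(S²V)^G = Σ_{χ̄ = χ} μ_χ(μ_χ + ν₂(χ)) +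
  Σ_{χ̄ ≠ χ} μ_χ μ_χ̄`), **`finrank_invariants_symmSq_eq_sum_classInner_of_repr`** (`dim(S²V)^G =
  Σ_{χ ∈ S} μ_χ μ_χ̄ + ½ Σ_{χ̄ = χ} μ_χ(μ_χ + ν₂(χ))` for a set `S` of representatives of the non-real irreducible
  characters modulo `χ ↦ χ̄`), **`finrank_invariants_symmSq_eq_zero_iff_forall_classInner`** and
  **`finrank_invariants_symmSq_eq_zero_iff_classInner`** (`dim(S²V)^G = 0 ↔ μ_χ μ_χ̄ = 0` for `χ̄ ≠ χ`, `μ_χ = 0`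
  for `ν₂(χ) = 1`, `μ_χ ≤ 1` for `ν₂(χ) = −1`).
* §2 (`G ≤ Aut M` finite, `σ = 𝓗¹(M)|_G`, `N = dim(S²𝓗¹(M))^G`):
  **`two_mul_finrank_invariants_symmSq_oneFormRep_eq_sum_classInner`** (`2N = Σ_χ μ_χ μ_χ̄ + Σ_χ ν₂(χ) μ_χ`),
  `finrank_invariants_symmSq_add_altSq_oneFormRep_eq_sum_classInner`,
  `finrank_invariants_symmSq_oneFormRep_eq_sum_classInner_of_repr`,
  **`two_mul_finrank_invariants_symmSq_oneFormRep_eq_add_sum_erase_one`** (`2N = γ(γ+1) + Σ_{χ ≠ 1}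
  (μ_χ μ_χ̄ + ν₂(χ) μ_χ)`), `finrank_invariants_symmSq_oneFormRep_eq_zero_iff_classInner` (the hypothesis of
  COROLLARY 3.11 in multiplicities) and
  **`arithGenus_orbitSurface_eq_zero_of_finrank_invariants_symmSq_oneFormRep_eq_zero`** (`N = 0 ⇒ γ = 0`, any
  finite `G`).

## References

* P. Frediani, A. Ghigi, M. Penegini, *Shimura varieties in the Torelli locus via Galois coverings*, Int. Math.
  Res. Not. IMRN 2015, no. 20, 10595–10623: 2.11–2.12 (2.4)–(2.6), Corollary 3.11, 3.12 (arXiv:1402.0973 pp. 14,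
  19). [FredianiGhigiPenegini2015]
* I. M. Isaacs, *Character Theory of Finite Groups*, Academic Press (1976): Corollary 2.14, Corollary 2.17,
  Lemma 4.4, Theorem 4.5. [Isaacs1976]
* G. James, M. Liebeck, *Representations and Characters of Groups*, 2nd ed. (2001): Proposition 13.15,
  Definition 23.13, Theorem 23.14. [JamesLiebeck2001]
* H. Lange, R. E. Rodríguez, *Decomposition of Jacobians by Prym Varieties*, LNM 2310 (2022), §3.5.4
  Theorem 3.5.15 (`μ_1 = γ`). [LangeRodriguez2022]
-/

noncomputable section

open scoped Manifold ContDiff Topology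
open Set Filter Function Complex MulAction Module
open Literature.RepresentationTheory.FiniteGroups

namespace Literature.Geometry.Kaehler

namespace RiemannSurface

/-! ### §1 `Σ_x χ_σ(x)² = |G| Σ_χ μ_χ μ_χ̄`, `Σ_x χ_σ(x²) = |G| Σ_χ ν₂(χ) μ_χ`, and `2 dim(S²V)^G` in multiplicities -/

section General

variable {G : Type} [Group G] [Fintype G] {V : Type} [AddCommGroup V] [Module ℂ V] [FiniteDimensional ℂ V]
  (σ : Representation ℂ G V)

/-- **«`χ_ρ = Σ_{χ ∈ Irr(G)} μ_χ χ`»** with `μ_χ = ⟨χ, χ_σ⟩ = classInner χ σ.character`, the multiplicity of the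
irreducible character `χ` in `σ` (`dim V_χ = χ(1)·μ_χ`, `finrank_range_isotypicProj`).
[cite: FredianiGhigiPenegini2015, 2.12 (2.6)] [cite: Isaacs1976, Cor. 2.14, Cor. 2.17] -/
theorem character_eq_sum_classInner_smul :
    σ.character = ∑ χ ∈ (irrChars_finite_holds G).toFinset, classInner χ σ.character • χ := by
  have hσ : IsCharacter G σ.character := ⟨V, inferInstance, inferInstance, inferInstance, σ, rfl⟩
  conv_lhs => rw [hσ.isClassFun.eq_sum_classInner_smul]
  exact Finset.sum_congr rfl fun χ _ ↦ by rw [classInner_comm]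

/-- `χ_σ(x) = Σ_{χ ∈ Irr(G)} μ_χ χ(x)`, pointwise form of «`χ_ρ = Σ μ_χ χ`».
[cite: FredianiGhigiPenegini2015, 2.12 (2.6)] [cite: Isaacs1976, Cor. 2.14, Cor. 2.17] -/
theorem character_apply_eq_sum_classInner_mul (x : G) :
    σ.character x = ∑ χ ∈ (irrChars_finite_holds G).toFinset, classInner χ σ.character * χ x := by
  have h := congr_fun (character_eq_sum_classInner_smul σ) x
  rw [Finset.sum_apply] at h
  rw [h]
  exact Finset.sum_congr rfl fun χ _ ↦ by rw [Pi.smul_apply, smul_eq_mul]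

/-- `⟨χ, ψ̄⟩ = ⟨χ̄, ψ⟩` for characters `χ`, `ψ` (both equal the natural number `[χ̄, ψ]`); private plumbing.
[folklore] -/
private theorem classInner_star_right_eq {χ ψ : G → ℂ} (hχ : IsCharacter G χ) (hψ : IsCharacter G ψ) :
    classInner χ (star ψ) = classInner (star χ) ψ := by
  obtain ⟨n, hn⟩ := hχ.star.classInner_natCast hψ
  have h := classInner_star_star (star χ) ψ
  rw [star_star] at h
  rw [h, hn, map_natCast]

/-- **`Σ_{x ∈ G} χ_σ(x)² = |G| · Σ_{χ ∈ Irr(G)} μ_χ μ_χ̄`** (`χ̄ = star χ`): the first sum of (2.6),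
`Σ_x (Σ_χ μ_χ χ(x))² = Σ_{χ,ψ} μ_χ μ_ψ Σ_x χ(x)ψ(x) = |G| Σ_{χ,ψ} μ_χ μ_ψ [χ, ψ̄]`, by the first orthogonality
relation («`[χ, χ̄] = [χ², 1_G]`»). [cite: FredianiGhigiPenegini2015, 2.12 (2.6)] [cite: Isaacs1976, Cor. 2.14, Thm. 4.5 (proof)] -/
theorem sum_character_sq_eq_card_mul_sum_classInner :
    ∑ x : G, σ.character x ^ 2 =
      (Fintype.card G : ℂ) * ∑ χ ∈ (irrChars_finite_holds G).toFinset,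
        classInner χ σ.character * classInner (star χ) σ.character := by
  have hc : (Fintype.card G : ℂ) ≠ 0 := Nat.cast_ne_zero.2 Fintype.card_ne_zero
  have hσ : IsCharacter G σ.character := ⟨V, inferInstance, inferInstance, inferInstance, σ, rfl⟩
  -- `Σ_x χ_σ(x)² = |G|·[χ_σ², 1_G] = |G|·[χ_σ, χ̄_σ]`
  have h1 : ∑ x : G, σ.character x ^ 2 = (Fintype.card G : ℂ) * classInner (σ.character * σ.character) 1 := by
    rw [classInner_apply, ← mul_assoc, mul_inv_cancel₀ hc, one_mul]
    exact Finset.sum_congr rfl fun x _ ↦ by rw [Pi.mul_apply, Pi.one_apply, mul_one, sq]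
  rw [h1, hσ.classInner_sq_one]
  congr 1
  -- expand the first argument, `χ_σ = Σ_χ μ_χ χ`, and use `[χ, χ̄_σ] = [χ̄, χ_σ] = μ_χ̄`
  have hexp := character_eq_sum_classInner_smul σ
  calc classInner σ.character (star σ.character)
      = classInner (∑ χ ∈ (irrChars_finite_holds G).toFinset, classInner χ σ.character • χ)
          (star σ.character) := by rw [← hexp]
    _ = ∑ χ ∈ (irrChars_finite_holds G).toFinset,
          classInner χ σ.character * classInner χ (star σ.character) := by
        rw [classInner_sum_left]
        exact Finset.sum_congr rfl fun χ _ ↦ classInner_smul_left _ _ _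
    _ = _ := Finset.sum_congr rfl fun χ hχ ↦ by
        rw [classInner_star_right_eq ((irrChars_finite_holds G).mem_toFinset.mp hχ).isCharacter hσ]

/-- **`Σ_{x ∈ G} χ_σ(x²) = |G| · Σ_{χ ∈ Irr(G)} ν₂(χ) μ_χ`**: the second sum of (2.6), `Σ_x Σ_χ μ_χ χ(x²) =
Σ_χ μ_χ Σ_x χ(x²)` with «`ν₂(χ) = |G|⁻¹ Σ_{g ∈ G} χ(g²)`». [cite: FredianiGhigiPenegini2015, 2.12 (2.6)]
[cite: Isaacs1976, Lemma 4.4] -/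
theorem sum_character_sq_apply_eq_card_mul_sum_frobeniusSchur :
    ∑ x : G, σ.character (x ^ 2) =
      (Fintype.card G : ℂ) * ∑ χ ∈ (irrChars_finite_holds G).toFinset,
        frobeniusSchur 2 χ * classInner χ σ.character := by
  have hc : (Fintype.card G : ℂ) ≠ 0 := Nat.cast_ne_zero.2 Fintype.card_ne_zero
  calc ∑ x : G, σ.character (x ^ 2)
      = ∑ x : G, ∑ χ ∈ (irrChars_finite_holds G).toFinset, classInner χ σ.character * χ (x ^ 2) :=
        Finset.sum_congr rfl fun x _ ↦ character_apply_eq_sum_classInner_mul σ (x ^ 2)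
    _ = ∑ χ ∈ (irrChars_finite_holds G).toFinset, classInner χ σ.character * ∑ x : G, χ (x ^ 2) := by
        rw [Finset.sum_comm]
        exact Finset.sum_congr rfl fun χ _ ↦ by rw [Finset.mul_sum]
    _ = _ := by
        rw [Finset.mul_sum]
        refine Finset.sum_congr rfl fun χ _ ↦ ?_
        rw [frobeniusSchur_apply, ← mul_assoc, ← mul_assoc, mul_inv_cancel₀ hc, one_mul, mul_comm]

/-- **(2.6), verbatim: `2|G|·N = Σ_{x ∈ G} ( (Σ_{χ ∈ Irr(G)} μ_χ χ(x))² + Σ_{χ ∈ Irr(G)} μ_χ χ(x²) )`**,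
`N = dim(S²V)^G`, `μ_χ = ⟨χ, χ_σ⟩`. [cite: FredianiGhigiPenegini2015, 2.12 (2.5), (2.6)] -/
theorem two_mul_card_mul_finrank_invariants_symmSq_eq_sum_sum :
    2 * (Fintype.card G : ℂ) * finrank ℂ ↥(Representation.symmSq σ).invariants =
      ∑ x : G, ((∑ χ ∈ (irrChars_finite_holds G).toFinset, classInner χ σ.character * χ x) ^ 2 +
        ∑ χ ∈ (irrChars_finite_holds G).toFinset, classInner χ σ.character * χ (x ^ 2)) := by
  rw [← Nat.card_eq_fintype_card, two_mul_card_mul_finrank_invariants_symmSq σ]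
  exact Finset.sum_congr rfl fun x _ ↦ by
    rw [← character_apply_eq_sum_classInner_mul, ← character_apply_eq_sum_classInner_mul]; rfl

/-- **`2 dim(S²V)^G = Σ_{χ ∈ Irr(G)} μ_χ μ_χ̄ + Σ_{χ ∈ Irr(G)} ν₂(χ) μ_χ`** — (2.5)–(2.6) with the sum over `G`
carried out by the orthogonality relations and the Frobenius–Schur count.
[cite: FredianiGhigiPenegini2015, 2.12 (2.5), (2.6)] [cite: Isaacs1976, Cor. 2.14, Lemma 4.4, Thm. 4.5] -/
theorem two_mul_finrank_invariants_symmSq_eq_sum_classInner :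
    2 * (finrank ℂ ↥(Representation.symmSq σ).invariants : ℂ) =
      ∑ χ ∈ (irrChars_finite_holds G).toFinset, classInner χ σ.character * classInner (star χ) σ.character +
        ∑ χ ∈ (irrChars_finite_holds G).toFinset, frobeniusSchur 2 χ * classInner χ σ.character := by
  have hc : (Fintype.card G : ℂ) ≠ 0 := Nat.cast_ne_zero.2 Fintype.card_ne_zero
  have h := two_mul_card_mul_finrank_invariants_symmSq σ
  rw [Nat.card_eq_fintype_card, Finset.sum_add_distrib] at h
  have hA := sum_character_sq_eq_card_mul_sum_classInner σ
  have hB := sum_character_sq_apply_eq_card_mul_sum_frobeniusSchur σ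
  change ∑ x : G, LinearMap.trace ℂ V (σ x) ^ 2 = _ at hA
  change ∑ x : G, LinearMap.trace ℂ V (σ (x ^ 2)) = _ at hB
  rw [hA, hB] at h
  refine mul_left_cancel₀ hc ?_
  linear_combination h

/-- `2 dim(Λ²V)^G = Σ_χ μ_χ μ_χ̄ − Σ_χ ν₂(χ) μ_χ` (the antisymmetric square, `2|G| dim(Λ²V)^G = Σ_x (χ(x)² − χ(x²))`).
[cite: JamesLiebeck2001, Thm. 23.14] [cite: Isaacs1976, Cor. 2.14, Lemma 4.4, Thm. 4.5] -/
theorem two_mul_finrank_invariants_altSq_eq_sum_classInner :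
    2 * (finrank ℂ ↥(Representation.altSq σ).invariants : ℂ) =
      ∑ χ ∈ (irrChars_finite_holds G).toFinset, classInner χ σ.character * classInner (star χ) σ.character -
        ∑ χ ∈ (irrChars_finite_holds G).toFinset, frobeniusSchur 2 χ * classInner χ σ.character := by
  have hc : (Fintype.card G : ℂ) ≠ 0 := Nat.cast_ne_zero.2 Fintype.card_ne_zero
  have h := two_mul_card_mul_finrank_invariants_altSq σ
  rw [Nat.card_eq_fintype_card, Finset.sum_sub_distrib] at h
  have hA := sum_character_sq_eq_card_mul_sum_classInner σ
  have hB := sum_character_sq_apply_eq_card_mul_sum_frobeniusSchur σ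
  change ∑ x : G, LinearMap.trace ℂ V (σ x) ^ 2 = _ at hA
  change ∑ x : G, LinearMap.trace ℂ V (σ (x ^ 2)) = _ at hB
  rw [hA, hB] at h
  refine mul_left_cancel₀ hc ?_
  linear_combination h

/-- `dim(S²V)^G + dim(Λ²V)^G = Σ_χ μ_χ μ_χ̄` (`= [χ_σ², 1_G] = [χ_σ, χ̄_σ]`, the invariants of `V ⊗ V = S²V ⊕ Λ²V`).
[cite: Isaacs1976, Thm. 4.5 (proof)] [cite: JamesLiebeck2001, Def. 23.13] -/
theorem finrank_invariants_symmSq_add_altSq_eq_sum_classInner :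
    (finrank ℂ ↥(Representation.symmSq σ).invariants : ℂ) + finrank ℂ ↥(Representation.altSq σ).invariants =
      ∑ χ ∈ (irrChars_finite_holds G).toFinset, classInner χ σ.character * classInner (star χ) σ.character := by
  have hS := two_mul_finrank_invariants_symmSq_eq_sum_classInner σ
  have hA := two_mul_finrank_invariants_altSq_eq_sum_classInner σ
  linear_combination (hS + hA) / 2

/-- `dim(S²V)^G − dim(Λ²V)^G = Σ_χ ν₂(χ) μ_χ` (`= ν₂(χ_σ) = [χ_S, 1_G] − [χ_A, 1_G]`).
[cite: Isaacs1976, Lemma 4.4, Thm. 4.5 (proof)] [cite: JamesLiebeck2001, Thm. 23.14] -/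
theorem finrank_invariants_symmSq_sub_altSq_eq_sum_frobeniusSchur :
    (finrank ℂ ↥(Representation.symmSq σ).invariants : ℂ) - finrank ℂ ↥(Representation.altSq σ).invariants =
      ∑ χ ∈ (irrChars_finite_holds G).toFinset, frobeniusSchur 2 χ * classInner χ σ.character := by
  have hS := two_mul_finrank_invariants_symmSq_eq_sum_classInner σ
  have hA := two_mul_finrank_invariants_altSq_eq_sum_classInner σ
  linear_combination (hS - hA) / 2

open Classical in
/-- **`2 dim(S²V)^G = Σ_{χ̄ = χ} μ_χ(μ_χ + ν₂(χ)) + Σ_{χ̄ ≠ χ} μ_χ μ_χ̄`**: the real irreducible characters contribute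
`μ(μ + 1)` (`ν₂ = 1`) or `μ(μ − 1)` (`ν₂ = −1`), the others `μ_χ μ_χ̄` («`ν₂(χ) ≠ 0` iff `χ` is real valued»).
[cite: FredianiGhigiPenegini2015, 2.12 (2.6)] [cite: Isaacs1976, Thm. 4.5 (b), (c)] -/
theorem two_mul_finrank_invariants_symmSq_eq_sum_filter_add :
    2 * (finrank ℂ ↥(Representation.symmSq σ).invariants : ℂ) =
      ∑ χ ∈ (irrChars_finite_holds G).toFinset with star χ = χ,
          classInner χ σ.character * (classInner χ σ.character + frobeniusSchur 2 χ) +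
        ∑ χ ∈ (irrChars_finite_holds G).toFinset with star χ ≠ χ,
          classInner χ σ.character * classInner (star χ) σ.character := by
  rw [two_mul_finrank_invariants_symmSq_eq_sum_classInner, ← Finset.sum_add_distrib,
    ← Finset.sum_filter_add_sum_filter_not _ (fun χ : G → ℂ ↦ star χ = χ)]
  congr 1
  · refine Finset.sum_congr rfl fun χ hχ ↦ ?_
    rw [Finset.mem_filter] at hχ
    rw [hχ.2]
    ring
  · refine Finset.sum_congr rfl fun χ hχ ↦ ?_
    rw [Finset.mem_filter] at hχ
    rw [((irrChars_finite_holds G).mem_toFinset.mp hχ.1).frobeniusSchur_two_eq_zero_iff.mpr hχ.2, zero_mul,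
      add_zero]

open Classical in
/-- **`dim(S²V)^G = Σ_{χ ∈ S} μ_χ μ_χ̄ + ½ Σ_{χ̄ = χ} μ_χ(μ_χ + ν₂(χ))`** for a set `S` of representatives of the
non-real irreducible characters modulo `χ ↦ χ̄` (the pairs `{χ, χ̄}` contribute `μ_χ μ_χ̄` each, the real characters
`μ(μ ± 1)/2`; for abelian `G` this is Moonen's `Σ d_{−n}d_n + d_k(d_k+1)/2`,
`finrank_invariants_symmSq_eq_of_repr`). [cite: FredianiGhigiPenegini2015, 2.12 (2.6)]
[cite: Isaacs1976, Cor. 2.14, Thm. 4.5] -/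
theorem finrank_invariants_symmSq_eq_sum_classInner_of_repr (S : Finset (G → ℂ))
    (hdisj : Disjoint S (S.image star))
    (hcover : S ∪ S.image star = (irrChars_finite_holds G).toFinset.filter fun χ ↦ star χ ≠ χ) :
    (finrank ℂ ↥(Representation.symmSq σ).invariants : ℂ) =
      ∑ χ ∈ S, classInner χ σ.character * classInner (star χ) σ.character +
        2⁻¹ * ∑ χ ∈ (irrChars_finite_holds G).toFinset with star χ = χ,
          classInner χ σ.character * (classInner χ σ.character + frobeniusSchur 2 χ) := by
  have h := two_mul_finrank_invariants_symmSq_eq_sum_filter_add σ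
  have hinj : Set.InjOn (star : (G → ℂ) → G → ℂ) ↑S := fun a _ b _ hab ↦ star_injective hab
  have h2 : ∑ χ ∈ (irrChars_finite_holds G).toFinset with star χ ≠ χ,
      classInner χ σ.character * classInner (star χ) σ.character =
      2 * ∑ χ ∈ S, classInner χ σ.character * classInner (star χ) σ.character := by
    rw [← hcover, Finset.sum_union hdisj, Finset.sum_image hinj, two_mul]
    congr 1
    exact Finset.sum_congr rfl fun χ _ ↦ by rw [star_star, mul_comm]
  rw [h2] at h
  linear_combination h / 2

/-- **`dim(S²V)^G = 0 ↔ μ_χ(μ_χ̄ + ν₂(χ)) = 0` for every `χ ∈ Irr(G)`** — every summand of `2 dim(S²V)^G =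
Σ_χ μ_χ(μ_χ̄ + ν₂(χ))` is a natural number (`μ_χ μ_χ̄`, `μ(μ+1)` or `μ(μ−1)` by the Frobenius–Schur trichotomy);
the hypothesis «`(S²H⁰(C, K_C))^G = {0}`» of Corollary 3.11 read through (2.6).
[cite: FredianiGhigiPenegini2015, 2.12 (2.6), Corollary 3.11] [cite: Isaacs1976, Cor. 2.17, Thm. 4.5 (b), (c)] -/
theorem finrank_invariants_symmSq_eq_zero_iff_forall_classInner :
    finrank ℂ ↥(Representation.symmSq σ).invariants = 0 ↔
      ∀ χ ∈ (irrChars_finite_holds G).toFinset,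
        classInner χ σ.character * (classInner (star χ) σ.character + frobeniusSchur 2 χ) = 0 := by
  have hσ : IsCharacter G σ.character := ⟨V, inferInstance, inferInstance, inferInstance, σ, rfl⟩
  -- every summand `μ_χ(μ_χ̄ + ν₂(χ))` is a natural number: `a(b+1)`, `a(a−1)` or `ab`
  have hnat : ∀ χ ∈ (irrChars_finite_holds G).toFinset, ∃ k : ℕ,
      classInner χ σ.character * (classInner (star χ) σ.character + frobeniusSchur 2 χ) = k := by
    intro χ hχ
    have hχ' : IsIrrChar G χ := (irrChars_finite_holds G).mem_toFinset.mp hχ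
    obtain ⟨a, ha⟩ := hχ'.isCharacter.classInner_natCast hσ
    obtain ⟨b, hb⟩ := hχ'.star.isCharacter.classInner_natCast hσ
    rcases hχ'.frobeniusSchur_two_trichotomy with h1 | h1 | h1
    · exact ⟨a * (b + 1), by rw [ha, hb, h1]; push_cast; ring⟩
    · -- `ν₂(χ) = −1`: `χ` is real valued, so `μ_χ̄ = μ_χ = a` and `a(a − 1) ∈ ℕ`
      have hreal : star χ = χ := hχ'.frobeniusSchur_two_ne_zero_iff.mp (by rw [h1]; norm_num)
      have hab : (b : ℂ) = a := by rw [← ha, ← hb, hreal]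
      rw [ha, hb, h1, hab]
      rcases Nat.eq_zero_or_pos a with h0 | hpos
      · exact ⟨0, by rw [h0]; push_cast; ring⟩
      · exact ⟨a * (a - 1), by rw [Nat.cast_mul, Nat.cast_pred hpos]; ring⟩
    · exact ⟨a * b, by rw [ha, hb, h1]; push_cast; ring⟩
  choose! k hk using hnat
  have h2 : 2 * (finrank ℂ ↥(Representation.symmSq σ).invariants : ℂ) =
      ∑ χ ∈ (irrChars_finite_holds G).toFinset, (k χ : ℂ) := by
    rw [two_mul_finrank_invariants_symmSq_eq_sum_classInner, ← Finset.sum_add_distrib]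
    refine Finset.sum_congr rfl fun χ hχ ↦ ?_
    rw [← hk χ hχ]
    ring
  have h3 : 2 * finrank ℂ ↥(Representation.symmSq σ).invariants =
      ∑ χ ∈ (irrChars_finite_holds G).toFinset, k χ := by
    exact_mod_cast h2
  constructor
  · intro h0 χ hχ
    rw [h0, mul_zero] at h3
    rw [hk χ hχ, Nat.cast_eq_zero]
    exact Finset.sum_eq_zero_iff.mp h3.symm χ hχ
  · intro hall
    have hsum : ∑ χ ∈ (irrChars_finite_holds G).toFinset, k χ = 0 :=
      Finset.sum_eq_zero fun χ hχ ↦ by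
        have h := hall χ hχ
        rw [hk χ hχ, Nat.cast_eq_zero] at h
        exact h
    rw [hsum] at h3
    omega

/-- **`dim(S²V)^G = 0 ↔ (μ_χ μ_χ̄ = 0` for `χ̄ ≠ χ`, `μ_χ = 0` for `ν₂(χ) = 1`, and `μ_χ ∈ {0, 1}` for `ν₂(χ) = −1)`**:
no pair of conjugate non-real irreducible characters occurs together, no character of orthogonal type occurs, and
the characters of symplectic type occur at most once (the hypothesis of Corollary 3.11 in multiplicities).
[cite: FredianiGhigiPenegini2015, 2.12 (2.6), Corollary 3.11] [cite: Isaacs1976, Thm. 4.5 (b), (c)] -/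
theorem finrank_invariants_symmSq_eq_zero_iff_classInner :
    finrank ℂ ↥(Representation.symmSq σ).invariants = 0 ↔
      (∀ χ ∈ (irrChars_finite_holds G).toFinset, star χ ≠ χ →
          classInner χ σ.character * classInner (star χ) σ.character = 0) ∧
      (∀ χ ∈ (irrChars_finite_holds G).toFinset, frobeniusSchur 2 χ = 1 → classInner χ σ.character = 0) ∧
      (∀ χ ∈ (irrChars_finite_holds G).toFinset, frobeniusSchur 2 χ = -1 →
          classInner χ σ.character = 0 ∨ classInner χ σ.character = 1) := by
  have hσ : IsCharacter G σ.character := ⟨V, inferInstance, inferInstance, inferInstance, σ, rfl⟩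
  rw [finrank_invariants_symmSq_eq_zero_iff_forall_classInner]
  constructor
  · intro h
    refine ⟨fun χ hχ hne ↦ ?_, fun χ hχ h1 ↦ ?_, fun χ hχ h1 ↦ ?_⟩
    · have h' := h χ hχ
      rwa [((irrChars_finite_holds G).mem_toFinset.mp hχ).frobeniusSchur_two_eq_zero_iff.mpr hne, add_zero] at h'
    · have h' := h χ hχ
      obtain ⟨b, hb⟩ := ((irrChars_finite_holds G).mem_toFinset.mp hχ).star.isCharacter.classInner_natCast hσ
      rw [h1, hb] at h'
      exact (mul_eq_zero.mp h').resolve_right (by exact_mod_cast Nat.succ_ne_zero b)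
    · have h' := h χ hχ
      have hreal : star χ = χ :=
        ((irrChars_finite_holds G).mem_toFinset.mp hχ).frobeniusSchur_two_ne_zero_iff.mp (by rw [h1]; norm_num)
      rw [h1, hreal] at h'
      rcases mul_eq_zero.mp h' with h0 | h0
      · exact Or.inl h0
      · exact Or.inr (by linear_combination h0)
  · rintro ⟨hA, hB, hC⟩ χ hχ
    have hχ' : IsIrrChar G χ := (irrChars_finite_holds G).mem_toFinset.mp hχ
    rcases hχ'.frobeniusSchur_two_trichotomy with h1 | h1 | h1
    · rw [hB χ hχ h1, zero_mul]
    · have hreal : star χ = χ := hχ'.frobeniusSchur_two_ne_zero_iff.mp (by rw [h1]; norm_num)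
      rw [hreal, h1]
      rcases hC χ hχ h1 with h0 | h0 <;> rw [h0] <;> ring
    · rw [h1, add_zero]
      exact hA χ hχ (hχ'.frobeniusSchur_two_eq_zero_iff.mp h1)

end General

/-! ### §2 `N = dim(S²𝓗¹(M))^G` in the multiplicities `μ_χ = ⟨χ, χ_{𝓗¹(M)}⟩` -/

section OneForms

variable {M : Type} [TopologicalSpace M] [ChartedSpace ℂ M] [IsManifold 𝓘(ℂ, ℂ) ω M]
  [CompactSpace M] [T2Space M] [PreconnectedSpace M] [Nonempty M] [Finite (autGroup M)]
  (G : Subgroup (autGroup M)) [Fintype ↥G]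

open OrbitSurface

/-- **`2N = Σ_{χ ∈ Irr(G)} μ_χ μ_χ̄ + Σ_{χ ∈ Irr(G)} ν₂(χ) μ_χ`, `N = dim(S²𝓗¹(M))^G`**, for a finite `G ≤ Aut M` of a
compact Riemann surface, `μ_χ = ⟨χ, χ_ρ⟩` the multiplicity of `χ` in `ρ = 𝓗¹(M)|_G` (given by the Chevalley–Weil
formula, `finrank_range_isotypicProj_oneFormRep_eq_sum_branchValues`): (2.5)–(2.6) with the sum over `G` carried
out. [cite: FredianiGhigiPenegini2015, 2.12 (2.5), (2.6)] [cite: Isaacs1976, Cor. 2.14, Lemma 4.4, Thm. 4.5] -/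
theorem two_mul_finrank_invariants_symmSq_oneFormRep_eq_sum_classInner :
    2 * (finrank ℂ ↥(Representation.invariants (Representation.symmSq ((oneFormRep M).comp G.subtype))) : ℂ) =
      ∑ χ ∈ (irrChars_finite_holds ↥G).toFinset,
          classInner χ (Representation.character ((oneFormRep M).comp G.subtype)) *
            classInner (star χ) (Representation.character ((oneFormRep M).comp G.subtype)) +
        ∑ χ ∈ (irrChars_finite_holds ↥G).toFinset,
          frobeniusSchur 2 χ * classInner χ (Representation.character ((oneFormRep M).comp G.subtype)) := by
  haveI : Module.Finite ℂ ↥(holomorphicOneForms M) := moduleFinite_holomorphicOneForms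
  exact two_mul_finrank_invariants_symmSq_eq_sum_classInner ((oneFormRep M).comp G.subtype)

/-- `dim(S²𝓗¹(M))^G + dim(Λ²𝓗¹(M))^G = Σ_χ μ_χ μ_χ̄` (the `G`-invariants of `𝓗¹(M) ⊗ 𝓗¹(M)`).
[cite: Isaacs1976, Thm. 4.5 (proof)] [cite: FredianiGhigiPenegini2015, 2.11 (2.4)] -/
theorem finrank_invariants_symmSq_add_altSq_oneFormRep_eq_sum_classInner :
    (finrank ℂ ↥(Representation.invariants (Representation.symmSq ((oneFormRep M).comp G.subtype))) : ℂ) +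
        finrank ℂ ↥(Representation.invariants (Representation.altSq ((oneFormRep M).comp G.subtype))) =
      ∑ χ ∈ (irrChars_finite_holds ↥G).toFinset,
        classInner χ (Representation.character ((oneFormRep M).comp G.subtype)) *
          classInner (star χ) (Representation.character ((oneFormRep M).comp G.subtype)) := by
  haveI : Module.Finite ℂ ↥(holomorphicOneForms M) := moduleFinite_holomorphicOneForms
  exact finrank_invariants_symmSq_add_altSq_eq_sum_classInner ((oneFormRep M).comp G.subtype)

open Classical in
/-- **`N = Σ_{χ ∈ S} μ_χ μ_χ̄ + ½ Σ_{χ̄ = χ} μ_χ(μ_χ + ν₂(χ))`** for a set `S` of representatives of the non-real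
irreducible characters of `G ≤ Aut M` modulo conjugation (generalizing the abelian
`finrank_invariants_symmSq_oneFormRep_eq_of_repr`, Moonen's `Σ d_{−n}d_n + d_k(d_k+1)/2`).
[cite: FredianiGhigiPenegini2015, 2.12 (2.6)] [cite: Isaacs1976, Cor. 2.14, Thm. 4.5] -/
theorem finrank_invariants_symmSq_oneFormRep_eq_sum_classInner_of_repr (S : Finset (↥G → ℂ))
    (hdisj : Disjoint S (S.image star))
    (hcover : S ∪ S.image star = (irrChars_finite_holds ↥G).toFinset.filter fun χ ↦ star χ ≠ χ) :
    (finrank ℂ ↥(Representation.invariants (Representation.symmSq ((oneFormRep M).comp G.subtype))) : ℂ) =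
      ∑ χ ∈ S, classInner χ (Representation.character ((oneFormRep M).comp G.subtype)) *
          classInner (star χ) (Representation.character ((oneFormRep M).comp G.subtype)) +
        2⁻¹ * ∑ χ ∈ (irrChars_finite_holds ↥G).toFinset with star χ = χ,
          classInner χ (Representation.character ((oneFormRep M).comp G.subtype)) *
            (classInner χ (Representation.character ((oneFormRep M).comp G.subtype)) + frobeniusSchur 2 χ) := by
  haveI : Module.Finite ℂ ↥(holomorphicOneForms M) := moduleFinite_holomorphicOneForms
  exact finrank_invariants_symmSq_eq_sum_classInner_of_repr ((oneFormRep M).comp G.subtype) S hdisj hcover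

/-- `1_G ∈ Irr(G)`; private plumbing. [folklore] -/
private theorem one_mem_irrChars' {K : Type} [Group K] [Finite K] : IsIrrChar K (1 : K → ℂ) := by
  have h1 := character_trivial_mem_irrChars (G := K)
  have h2 : (Representation.trivial ℂ K ℂ).character = 1 := by
    funext x; simp [Representation.character]
  rwa [h2] at h1

/-- **`2N = γ(γ + 1) + Σ_{χ ∈ Irr(G), χ ≠ 1} (μ_χ μ_χ̄ + ν₂(χ) μ_χ)`**, `γ = g(M/G)`: the trivial character is real
with `ν₂(1) = 1` and multiplicity `μ_1 = γ` in `𝓗¹(M)`, so `S²(𝓗¹(M)^G)` contributes `γ(γ+1)/2` to `N`.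
[cite: FredianiGhigiPenegini2015, 2.12 (2.6), 3.12] [cite: LangeRodriguez2022, §3.5.4 Thm. 3.5.15]
[cite: Isaacs1976, Lemma 4.4] -/
theorem two_mul_finrank_invariants_symmSq_oneFormRep_eq_add_sum_erase_one :
    2 * (finrank ℂ ↥(Representation.invariants (Representation.symmSq ((oneFormRep M).comp G.subtype))) : ℂ) =
      (arithGenus (OrbitSurface G M) : ℂ) * (arithGenus (OrbitSurface G M) + 1) +
        ∑ χ ∈ ((irrChars_finite_holds ↥G).toFinset).erase 1,
          (classInner χ (Representation.character ((oneFormRep M).comp G.subtype)) *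
              classInner (star χ) (Representation.character ((oneFormRep M).comp G.subtype)) +
            frobeniusSchur 2 χ * classInner χ (Representation.character ((oneFormRep M).comp G.subtype))) := by
  have h1 : (1 : ↥G → ℂ) ∈ (irrChars_finite_holds ↥G).toFinset :=
    (irrChars_finite_holds ↥G).mem_toFinset.mpr one_mem_irrChars'
  rw [two_mul_finrank_invariants_symmSq_oneFormRep_eq_sum_classInner, ← Finset.sum_add_distrib,
    ← Finset.add_sum_erase _ _ h1, star_one, frobeniusSchur_two_one, classInner_one_character_oneFormRep]
  ring

/-- **The hypothesis of COROLLARY 3.11 in multiplicities**: `(S²𝓗¹(M))^G = 0` iff no two conjugate non-real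
irreducible characters both occur in `𝓗¹(M)`, no character of orthogonal type (`ν₂ = 1`) occurs, and every
character of symplectic type (`ν₂ = −1`) occurs at most once («then `J(C)` is an abelian variety of CM type» — the
CM conclusion is not formalised here). [cite: FredianiGhigiPenegini2015, 2.12 (2.6), Corollary 3.11]
[cite: Isaacs1976, Thm. 4.5 (b), (c)] -/
theorem finrank_invariants_symmSq_oneFormRep_eq_zero_iff_classInner :
    finrank ℂ ↥(Representation.invariants (Representation.symmSq ((oneFormRep M).comp G.subtype))) = 0 ↔
      (∀ χ ∈ (irrChars_finite_holds ↥G).toFinset, star χ ≠ χ →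
          classInner χ (Representation.character ((oneFormRep M).comp G.subtype)) *
            classInner (star χ) (Representation.character ((oneFormRep M).comp G.subtype)) = 0) ∧
      (∀ χ ∈ (irrChars_finite_holds ↥G).toFinset, frobeniusSchur 2 χ = 1 →
          classInner χ (Representation.character ((oneFormRep M).comp G.subtype)) = 0) ∧
      (∀ χ ∈ (irrChars_finite_holds ↥G).toFinset, frobeniusSchur 2 χ = -1 →
          classInner χ (Representation.character ((oneFormRep M).comp G.subtype)) = 0 ∨
            classInner χ (Representation.character ((oneFormRep M).comp G.subtype)) = 1) := by
  haveI : Module.Finite ℂ ↥(holomorphicOneForms M) := moduleFinite_holomorphicOneForms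
  exact finrank_invariants_symmSq_eq_zero_iff_classInner ((oneFormRep M).comp G.subtype)

/-- **`N = 0` forces `g(M/G) = 0`** for ANY finite `G ≤ Aut M` (`γ(γ+1)/2 ≤ N` from the trivial character; 3.12:
«if `C` and `G` satisfy the hypothesis of Corollary 3.11, then clearly the corresponding family is a point»; the
abelian case is `arithGenus_orbitSurface_eq_zero_of_finrank_invariants_symmSq_eq_zero`).
[cite: FredianiGhigiPenegini2015, Corollary 3.11, 3.12] [cite: LangeRodriguez2022, §3.5.4 Thm. 3.5.15] -/
theorem arithGenus_orbitSurface_eq_zero_of_finrank_invariants_symmSq_oneFormRep_eq_zero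
    (h0 : finrank ℂ ↥(Representation.invariants (Representation.symmSq ((oneFormRep M).comp G.subtype))) = 0) :
    arithGenus (OrbitSurface G M) = 0 := by
  haveI : Module.Finite ℂ ↥(holomorphicOneForms M) := moduleFinite_holomorphicOneForms
  have h1 : (1 : ↥G → ℂ) ∈ (irrChars_finite_holds ↥G).toFinset :=
    (irrChars_finite_holds ↥G).mem_toFinset.mpr one_mem_irrChars'
  have h := (finrank_invariants_symmSq_eq_zero_iff_forall_classInner ((oneFormRep M).comp G.subtype)).mp h0 1 h1
  rw [star_one, frobeniusSchur_two_one, classInner_one_character_oneFormRep] at h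
  have h' : ((arithGenus (OrbitSurface G M) * (arithGenus (OrbitSurface G M) + 1) : ℕ) : ℂ) = 0 := by
    push_cast
    exact h
  rw [Nat.cast_eq_zero, mul_eq_zero] at h'
  omega

end OneForms

end RiemannSurface

end Literature.Geometry.Kaehler
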